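import Mathlib

/-!
# Tier4/Line1/NormOneTorusAlgebra — the quadratic algebra `R[√−d]` on pairs: multiplication, conjugation, norm

Blind re-derivation cell `pub-hodge-repro`, Tier 4 (README §9–§10), seat t4-L1-p5 (prover, LINE L1, gen 2).
The torus case of the cocompactness wall (rung `hstab` (ii) of the R-c cut, `proofs/t4/L1/I1-c-CENSUS.md` §7) lives
on `𝔸_k² = k(√−d) ⊗_k 𝔸_k`; this module is its commutative algebra over an arbitrary commutative ring `R`, written on
`Fin 2 → R` with the basis `(1, √−d)`: `qmul d` (the multiplication `(x, y)(x′, y′) = (xx′ − d yy′, xy′ + yx′)`),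
`qconj` (the conjugation `(x, y) ↦ (x, −y)`), `qnorm d` (the norm form `x² + d y²`), `qone = (1, 0)`; the identities
(commutative, associative, unital; `z z̄ = N(z)·1`; `N` multiplicative; conjugation multiplicative and involutive);
continuity of the multiplication in a topological ring; transport along a ring homomorphism; the inverse `qinv` over a
field and the anisotropy of the norm form when `−d` is not a square.  Everything is `ring`-level; Mathlib-only.

Nothing here says anything about the status of the Hodge conjecture for CM abelian varieties, which is NOT proved
(HC_CM is NOT proved by anyone in this repository).
-/

set_option autoImplicit false

noncomputable section

namespace Summit.Ventures.HodgeRepro.Tier4.Line1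

section Quadratic

variable {R : Type*} [CommRing R]

/-- multiplication of `R[√−d] = R ⊕ R·√−d` on pairs: `(x, y)(x′, y′) = (xx′ − d yy′, xy′ + yx′)` -/
def qmul (d : R) (z w : Fin 2 → R) : Fin 2 → R :=
  ![z 0 * w 0 - d * (z 1 * w 1), z 0 * w 1 + z 1 * w 0]

/-- the conjugation `(x, y) ↦ (x, −y)` of `R[√−d]` -/
def qconj (z : Fin 2 → R) : Fin 2 → R := ![z 0, -z 1]

/-- the norm form `N(x, y) = x² + d y²` of `R[√−d]` -/
def qnorm (d : R) (z : Fin 2 → R) : R := z 0 * z 0 + d * (z 1 * z 1)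

/-- the unit `(1, 0)` of `R[√−d]` -/
def qone : Fin 2 → R := ![1, 0]

/-- first coordinate of the product -/
@[simp] theorem qmul_apply_zero (d : R) (z w : Fin 2 → R) :
    qmul d z w 0 = z 0 * w 0 - d * (z 1 * w 1) := by simp [qmul]

/-- second coordinate of the product -/
@[simp] theorem qmul_apply_one (d : R) (z w : Fin 2 → R) :
    qmul d z w 1 = z 0 * w 1 + z 1 * w 0 := by simp [qmul]

/-- first coordinate of the conjugate -/
@[simp] theorem qconj_apply_zero (z : Fin 2 → R) : qconj z 0 = z 0 := by simp [qconj]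

/-- second coordinate of the conjugate -/
@[simp] theorem qconj_apply_one (z : Fin 2 → R) : qconj z 1 = -z 1 := by simp [qconj]

/-- first coordinate of the unit -/
@[simp] theorem qone_apply_zero : (qone : Fin 2 → R) 0 = 1 := by simp [qone]

/-- second coordinate of the unit -/
@[simp] theorem qone_apply_one : (qone : Fin 2 → R) 1 = 0 := by simp [qone]

/-- the multiplication is commutative -/
theorem qmul_comm (d : R) (z w : Fin 2 → R) : qmul d z w = qmul d w z := by
  funext i
  fin_cases i <;> simp <;> ring

/-- the multiplication is associative -/
theorem qmul_assoc (d : R) (z w u : Fin 2 → R) : qmul d (qmul d z w) u = qmul d z (qmul d w u) := by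
  funext i
  fin_cases i <;> simp <;> ring

/-- `(1, 0)` is a right unit -/
theorem qmul_qone (d : R) (z : Fin 2 → R) : qmul d z qone = z := by
  funext i
  fin_cases i <;> simp

/-- `(1, 0)` is a left unit -/
theorem qone_qmul (d : R) (z : Fin 2 → R) : qmul d qone z = z := by
  funext i
  fin_cases i <;> simp

/-- the multiplication is additive in the left factor -/
theorem add_qmul (d : R) (z z' w : Fin 2 → R) : qmul d (z + z') w = qmul d z w + qmul d z' w := by
  funext i
  fin_cases i <;> simp <;> ring

/-- the multiplication is additive in the right factor -/
theorem qmul_add (d : R) (z w w' : Fin 2 → R) : qmul d z (w + w') = qmul d z w + qmul d z w' := by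
  funext i
  fin_cases i <;> simp <;> ring

/-- scalars pull out of the multiplication -/
theorem qmul_smul (d : R) (c : R) (z w : Fin 2 → R) : qmul d z (c • w) = c • qmul d z w := by
  funext i
  fin_cases i <;> simp <;> ring

/-- `z z̄ = N(z) · (1, 0)` -/
theorem qmul_qconj_self (d : R) (z : Fin 2 → R) : qmul d z (qconj z) = qnorm d z • qone := by
  funext i
  fin_cases i
  · simp [qnorm]
  · simp [qnorm]
    ring

/-- `z z̄ = (1, 0)` when `N(z) = 1` -/
theorem qmul_qconj_self_of_qnorm_eq_one (d : R) {z : Fin 2 → R} (hz : qnorm d z = 1) :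
    qmul d z (qconj z) = qone := by
  rw [qmul_qconj_self, hz, one_smul]

/-- the norm form is multiplicative -/
theorem qnorm_qmul (d : R) (z w : Fin 2 → R) : qnorm d (qmul d z w) = qnorm d z * qnorm d w := by
  simp [qnorm]
  ring

/-- conjugation is multiplicative -/
theorem qconj_qmul (d : R) (z w : Fin 2 → R) : qconj (qmul d z w) = qmul d (qconj z) (qconj w) := by
  funext i
  fin_cases i
  · simp
  · simp
    ring

/-- conjugation is an involution -/
theorem qconj_qconj (z : Fin 2 → R) : qconj (qconj z) = z := by
  funext i
  fin_cases i <;> simp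

/-- conjugation preserves the norm form -/
theorem qnorm_qconj (d : R) (z : Fin 2 → R) : qnorm d (qconj z) = qnorm d z := by
  simp [qnorm]

/-- conjugation is additive -/
theorem qconj_add (z w : Fin 2 → R) : qconj (z + w) = qconj z + qconj w := by
  funext i
  fin_cases i
  · simp
  · simp
    ring

/-- the norm form of a scalar multiple -/
theorem qnorm_smul (d : R) (c : R) (z : Fin 2 → R) : qnorm d (c • z) = c * c * qnorm d z := by
  simp [qnorm]
  ring

/-- the norm form of `(1, 0)` -/
theorem qnorm_qone (d : R) : qnorm d (qone : Fin 2 → R) = 1 := by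
  simp [qnorm]

section Continuity

variable [TopologicalSpace R] [IsTopologicalRing R]

/-- multiplication by a fixed right factor is continuous -/
theorem continuous_qmul_right (d : R) (t : Fin 2 → R) : Continuous fun z : Fin 2 → R => qmul d z t := by
  refine continuous_pi fun i => ?_
  fin_cases i
  · show Continuous fun z : Fin 2 → R => z 0 * t 0 - d * (z 1 * t 1)
    fun_prop
  · show Continuous fun z : Fin 2 → R => z 0 * t 1 + z 1 * t 0
    fun_prop

/-- conjugation is continuous -/
theorem continuous_qconj : Continuous fun z : Fin 2 → R => qconj z := by
  refine continuous_pi fun i => ?_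
  fin_cases i
  · show Continuous fun z : Fin 2 → R => z 0
    fun_prop
  · show Continuous fun z : Fin 2 → R => -z 1
    fun_prop

/-- the norm form is continuous -/
theorem continuous_qnorm (d : R) : Continuous fun z : Fin 2 → R => qnorm d z := by
  show Continuous fun z : Fin 2 → R => z 0 * z 0 + d * (z 1 * z 1)
  fun_prop

end Continuity

section Transport

variable {S : Type*} [CommRing S] (f : R →+* S)

/-- transport of the multiplication along a ring homomorphism -/
theorem qmul_map (d : R) (z w : Fin 2 → R) :
    (fun i => f (qmul d z w i)) = qmul (f d) (fun i => f (z i)) (fun i => f (w i)) := by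
  funext i
  fin_cases i <;> simp

/-- transport of the conjugation along a ring homomorphism -/
theorem qconj_map (z : Fin 2 → R) : (fun i => f (qconj z i)) = qconj (fun i => f (z i)) := by
  funext i
  fin_cases i <;> simp

/-- transport of the norm form along a ring homomorphism -/
theorem qnorm_map (d : R) (z : Fin 2 → R) : f (qnorm d z) = qnorm (f d) (fun i => f (z i)) := by
  simp [qnorm]

end Transport

end Quadratic

section Field

variable {K : Type*} [Field K]

/-- the inverse `z⁻¹ = N(z)⁻¹ z̄` in `K[√−d]` -/
def qinv (d : K) (z : Fin 2 → K) : Fin 2 → K := (qnorm d z)⁻¹ • qconj z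

/-- `z z⁻¹ = (1, 0)` when `N(z) ≠ 0` -/
theorem qmul_qinv (d : K) {z : Fin 2 → K} (hz : qnorm d z ≠ 0) : qmul d z (qinv d z) = qone := by
  rw [qinv, qmul_smul, qmul_qconj_self, smul_smul, inv_mul_cancel₀ hz, one_smul]

/-- the norm of the inverse -/
theorem qnorm_qinv (d : K) {z : Fin 2 → K} (hz : qnorm d z ≠ 0) : qnorm d (qinv d z) = (qnorm d z)⁻¹ := by
  rw [qinv, qnorm_smul, qnorm_qconj]
  field_simp

/-- **anisotropy**: when `−d` is not a square in `K`, the norm form `x² + d y²` has no non-trivial zero. -/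
theorem qnorm_ne_zero_of_not_isSquare {d : K} (hd : ¬ IsSquare (-d)) {z : Fin 2 → K} (hz : z ≠ 0) :
    qnorm d z ≠ 0 := by
  intro h
  simp only [qnorm] at h
  by_cases h1 : z 1 = 0
  · rw [h1, mul_zero, mul_zero, add_zero, mul_self_eq_zero] at h
    apply hz
    funext i
    fin_cases i
    · exact h
    · exact h1
  · apply hd
    refine ⟨z 0 / z 1, ?_⟩
    field_simp
    linear_combination -h

end Field

end Summit.Ventures.HodgeRepro.Tier4.Line1

end
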